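import Summits.BirchSwinnertonDyer.BirchSwinnertonDyer.Theorems.SignedLowerHalvesSmallImageLowerHalfBothSignsLambdaLowerThreeNsThetaPartnerFrame
import Literature.NumberTheory.GaloisRepresentations.FrobeniusPlaces
import Literature.NumberTheory.GaloisRepresentations.TeichmullerLiftMonomial
import Literature.NumberTheory.GaloisRepresentations.IntegralGaloisActionProofs
import Literature.NumberTheory.GaloisRepresentations.RestrictFieldSemisimple
import Literature.NumberTheory.GaloisRepresentations.ArtinFormalismInductionProofs
import Literature.NumberTheory.EllipticCurves.HeckeLFunctionEqLSeriesOfLocalFactors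
import Literature.NumberTheory.EllipticCurves.SupersingularDensitySerreTraceProofs
import Literature.FieldTheory.AlgClosed.PadicAlgClEquivComplex
import Literature.NumberTheory.EllipticCurves.HidaFamilyMembersOrdinaryRankProofs
import HarnessLib

/-!
# The trace congruence `a_ℓ(θ_ψ) ≡ a_ℓ(E) (mod 𝔪_{ℤ̄_p})` of the odd-`p` theta partner (brick R5)

Route `SignedLowerHalves`, child L `SmallImageLowerHalfBothSigns` (item stmt-BirchSwinnertonDyer-23599), line
proposal `rtt_w3`, stub K0₂@p `stub_heckeThetaPartner_ns` — brick R5 ("trace congruence") of the arithmetic half at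
an ODD prime (width seat `bsd-line-slh-p3-w3` gen 9; memo `Lines/birth_acns-MEMO-w3-g9.md`).  THEOREMS ONLY (no
definition, no named fact, no `sorry`); ROUTE-INDEPENDENT.

Setting (the frame of `…ThetaPartnerFrame`): `Φ : Aut(E[p]) ≃ GL₂(𝔽_p)`, `k ⊆ M₂(𝔽_p)` a field with `[k : 𝔽_p] = 2`,
the image of `ρ̄ = ρ̄_{E,p}` normalises `kˣ`, `U = ρ̄⁻¹(kˣ)`; `K/ℚ` a quadratic Galois number field with
`res(Γ_K) = U` (`hKU`, `hUK`); `j : k →+* 𝔽̄_p`, `e : ℚ̄_p ≃ ℂ`, `T` a Teichmüller section of exponent `p² − 1`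
(`…ThetaPartnerArtinChar.exists_heckeCharacter_teichmuller`); a function `χᵥ` on the places of `K` whose value at
every `w ∣ ℓ` is `e(T(j(Φρ̄(res Frob_w))))` for every arithmetic Frobenius `Frob_w ∈ Γ_K` (the values `η(ϖ_w)` of
the Hecke character of `χ = Teich ∘ j ∘ Φρ̄ ∘ res`), and a function `ψ` with `ψ(w) ≡ χᵥ(w)` `p`-adically at the
`w ∣ ℓ` (the twisted Größencharakter).  Then for a good prime `ℓ ≠ p` of `E` unramified in `K`:

  `‖e⁻¹(∑_{N w = ℓ} ψ(w)) − a_ℓ(E)‖ < 1`   (`norm_finsum_sub_frobeniusTrace_lt_one`).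

Proof (Serre 1972 §2.2, §4.2 c); Ribet 1977 §3): let `Frob_ℓ ∈ Γ_ℚ` be a Frobenius at a prime `𝔓₀ ∣ ℓ` of `ℤ̄`.
* `Frob_ℓ ∈ U` (`ℓ` split, `…FrobeniusPlaces.exists_places_split_of_mem_range`): the places of norm `ℓ` are
  `w₀ ≠ w₁` with Frobenius elements restricting to `Frob_ℓ`, `c Frob_ℓ c⁻¹` (`c ∉ U`); the two values
  `y₀ = Φρ̄(Frob_ℓ)`, `y₁ = Φρ̄(c Frob_ℓ c⁻¹) = ȳ₀` in `k` add up to `a_ℓ(E)·1`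
  (`…ThetaPartnerFrame.frob_add_conj_eq_frobeniusTrace_smul_one_of_mem`), so
  `T(j y₀) + T(j y₁) ≡ j(y₀ + y₁) = a_ℓ(E)` modulo `𝔪_{ℤ̄_p}`;
* `Frob_ℓ ∉ U` (`ℓ` inert, `…exists_place_inert_of_not_mem_range`, the inertia at `ℓ` acting trivially on
  `E[p]`): no place has norm `ℓ`, the sum is `0`, and `p ∣ a_ℓ(E)` (`…dvd_frobeniusTrace_of_frob_not_mem`).

This is the hypothesis `htrace` of the odd socket `…ThetaPartnerOdd.heckeThetaPartner_of_arithmeticHalf`.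
BSD, crux L and the stub are NOT proved here.

References: J.-P. Serre, Invent. Math. 15 (1972) §2.2, §4.2; K. Ribet, LNM 601 (1977) §3; J. Neukirch, ANT I §9.
-/

set_option autoImplicit false
set_option linter.dupNamespace false

noncomputable section

open scoped Classical NumberField MatrixGroups
open IsDedekindDomain Field Matrix NumberField WeierstrassCurve Literature.NumberTheory.EllipticCurves
  Literature.NumberTheory.GaloisRepresentations Rat.HeightOneSpectrum
  Literature.NumberTheory.EllipticCurves.Rank1Residual

namespace Summit.BirchSwinnertonDyer.BirchSwinnertonDyer.Theorems.SmallImageLambdaLowerThreeNsThetaPartner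

/-! ### §1. Small lemmas -/

section Small

variable {p : ℕ} [Fact p.Prime]

/-- Three-term ultrametric estimate in `ℚ̄_p`: `‖x + y + z‖ < 1` if each term has norm `< 1`. [folklore] -/
theorem norm_add_add_lt_one' {x y z : PadicAlgCl p} (hx : ‖x‖ < 1) (hy : ‖y‖ < 1) (hz : ‖z‖ < 1) :
    ‖x + y + z‖ < 1 :=
  (IsUltrametricDist.norm_add_le_max _ _).trans_lt
    (max_lt ((IsUltrametricDist.norm_add_le_max _ _).trans_lt (max_lt hx hy)) hz)

/-- An element of `ℤ̄_p` with residue `0` has norm `< 1`. [folklore] -/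
theorem norm_lt_one_of_residue_eq_zero {x : padicAlgClIntegers p}
    (hx : IsLocalRing.residue (padicAlgClIntegers p) x = 0) : ‖(x : PadicAlgCl p)‖ < 1 := by
  rw [IsLocalRing.residue_eq_zero_iff] at hx
  exact (mem_maximalIdeal_padicAlgClIntegers_iff_norm_lt_one x).mp hx

variable {K : Type} [Field K] [NumberField K]

/-- A prime of norm `ℓ` contains `ℓ`. [folklore] -/
theorem natCast_mem_of_absNorm_eq' {ℓ : ℕ} {w : HeightOneSpectrum (𝓞 K)} (hw : Ideal.absNorm w.asIdeal = ℓ) :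
    (ℓ : 𝓞 K) ∈ w.asIdeal := by
  have := Ideal.absNorm_mem w.asIdeal
  rwa [hw] at this

/-- `N w = ℓ^{f(w|ℓ)}` for a place `w` of `K` above the place `v` of `ℚ` at `ℓ`. [folklore] -/
theorem absNorm_eq_pow_inertiaDeg_of_under_eq {v : HeightOneSpectrum (𝓞 ℚ)} {ℓ : ℕ}
    (hv : (primesEquiv v : ℕ) = ℓ) {w : HeightOneSpectrum (𝓞 K)} (hw : w.under (𝓞 ℚ) = v) :
    Ideal.absNorm w.asIdeal = ℓ ^ w.asIdeal.inertiaDeg (𝓞 ℚ) := by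
  have h := residueCard_eq_residueCard_pow_inertiaDeg (F := ℚ) (M := K) (v := v) (w := w)
    (congrArg HeightOneSpectrum.asIdeal hw)
  rw [Rat.residueCard_eq_natGenerator] at h
  rw [← hv]
  exact h

end Small

/-! ### §2. The trace congruence -/

section Curve

variable (W : WeierstrassCurve ℚ) [W.IsElliptic] [W.IsGloballyMinimal] (p : ℕ) [Fact p.Prime]
  (Φ : Multiplicative (AddAut (geomTorsion W p)) ≃* GL (Fin 2) (ZMod p))
  {k : Subalgebra (ZMod p) (Matrix (Fin 2) (Fin 2) (ZMod p))}
  (K : Type) [Field K] [NumberField K] [IsGalois ℚ K]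

/-- **The trace congruence `‖e⁻¹(∑_{N w = ℓ} ψ(w)) − a_ℓ(E)‖ < 1`** at a good prime `ℓ ≠ p` of `E` unramified in
the quadratic field `K` cut out by `U = ρ̄⁻¹(kˣ)`, for any function `ψ` on the places of `K` congruent at the
`w ∣ ℓ` to the Frobenius values `χᵥ(w) = e(T(j(Φρ̄(res Frob_w))))`.  See the module docstring.
[cite: Serre1972, §2.2, §4.2 c)] -/
theorem norm_finsum_sub_frobeniusTrace_lt_one (hk : IsField k) (h2 : Module.finrank (ZMod p) k = 2)
    (htr : letI : Module (ZMod p) (geomTorsion W p) := AddSubgroup.torsionBy.zmodModule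
      ∀ g : Multiplicative (AddAut (geomTorsion W p)),
        Matrix.trace ((Φ g : GL (Fin 2) (ZMod p)) : Matrix (Fin 2) (Fin 2) (ZMod p)) =
          LinearMap.trace (ZMod p) (geomTorsion W p) ((Multiplicative.toAdd g).toAddMonoidHom.toZModLinearMap p))
    (hGN : (galoisRepTorsion W p).range.map Φ.toMonoidHom ≤
      Subgroup.normalizer (Serre1972.unitGroup k : Set (GL (Fin 2) (ZMod p))))
    (hK2 : Module.finrank ℚ K = 2)
    (hKU : ∀ τ : absoluteGaloisGroup K,
      Φ (galoisRepTorsion W p (absGaloisRestrict ℚ K τ)) ∈ Serre1972.unitGroup k)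
    (hUK : ∀ σ : absoluteGaloisGroup ℚ,
      Φ (galoisRepTorsion W p σ) ∈ Serre1972.unitGroup k → σ ∈ (absGaloisRestrict ℚ K).range)
    (j : k →+* padicAlgClResidueField p) (e : PadicAlgCl p ≃+* ℂ)
    (T : padicAlgClResidueField p → padicAlgClIntegers p)
    (hT : ∀ z, z ^ (p ^ 2 - 1) = 1 →
      (T z : PadicAlgCl p) ^ (p ^ 2 - 1) = 1 ∧ IsLocalRing.residue (padicAlgClIntegers p) (T z) = z)
    (hjpow : ∀ τ : absoluteGaloisGroup K,
      (j ⟨(Φ (galoisRepTorsion W p (absGaloisRestrict ℚ K τ)) : Matrix (Fin 2) (Fin 2) (ZMod p)), hKU τ⟩) ^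
        (p ^ 2 - 1) = 1)
    (χv ψ : HeightOneSpectrum (𝓞 K) → ℂ)
    {ℓ : ℕ} [Fact ℓ.Prime] (hℓp : ℓ ≠ p) (hgood : W.HasGoodReductionAtPrime ℓ)
    {v : HeightOneSpectrum (𝓞 ℚ)} (hv : (primesEquiv v : ℕ) = ℓ) (hunr : Algebra.IsUnramifiedIn (𝓞 K) v.asIdeal)
    (hχv : ∀ w : HeightOneSpectrum (𝓞 K), (ℓ : 𝓞 K) ∈ w.asIdeal →
      ∀ 𝔔 ∈ w.primesAbove, ∀ F : absoluteGaloisGroup K, IsArithFrobAt (𝓞 K) F 𝔔 →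
        χv w = e (T (j ⟨(Φ (galoisRepTorsion W p (absGaloisRestrict ℚ K F)) : Matrix (Fin 2) (Fin 2) (ZMod p)),
          hKU F⟩)))
    (hψ : ∀ w : HeightOneSpectrum (𝓞 K), (ℓ : 𝓞 K) ∈ w.asIdeal → ‖e.symm (ψ w) - e.symm (χv w)‖ < 1) :
    ‖e.symm (∑ᶠ (w : HeightOneSpectrum (𝓞 K)) (_ : Ideal.absNorm w.asIdeal = ℓ), ψ w) -
      (W.frobeniusTrace ℓ : PadicAlgCl p)‖ < 1 := by
  have hℓ : ℓ.Prime := Fact.out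
  set H : Subgroup (absoluteGaloisGroup ℚ) := (absGaloisRestrict ℚ K).range with hHdef
  have hHn : H.Normal := normal_range_absGaloisRestrict ℚ K
  have hHi : H.index = Module.finrank ℚ K := index_range_absGaloisRestrict_eq_finrank ℚ K
  have hl : (Module.finrank ℚ K).Prime := by rw [hK2]; exact Nat.prime_two
  -- membership in `H = U`
  have hmemH : ∀ σ : absoluteGaloisGroup ℚ, σ ∈ H ↔ Φ (galoisRepTorsion W p σ) ∈ Serre1972.unitGroup k := by
    intro σ
    refine ⟨?_, hUK σ⟩
    rintro ⟨τ, rfl⟩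
    exact hKU τ
  have hmemU : ∀ σ : absoluteGaloisGroup ℚ,
      σ ∈ ((Serre1972.unitGroup k).comap Φ.toMonoidHom).comap (galoisRepTorsion W p) ↔
        Φ (galoisRepTorsion W p σ) ∈ Serre1972.unitGroup k := fun σ => Iff.rfl
  -- an element outside `H`
  have hHtop : H ≠ ⊤ := by
    intro h
    rw [h, Subgroup.index_top, hK2] at hHi
    exact absurd hHi (by norm_num)
  obtain ⟨c, hc⟩ : ∃ c : absoluteGaloisGroup ℚ, c ∉ H := by
    by_contra h
    push Not at h
    exact hHtop (eq_top_iff.mpr fun x _ => h x)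
  -- a prime of `ℤ̄` above `ℓ` and a Frobenius there
  obtain ⟨𝔓₀, h𝔓₀⟩ := v.primesAbove_nonempty
  obtain ⟨Fr, hFr⟩ := HeightOneSpectrum.exists_isArithFrobAt_of_mem_primesAbove_holds (K := ℚ) (v := v) h𝔓₀
  -- places above `v` and the prime `ℓ`
  have hwv : ∀ w : HeightOneSpectrum (𝓞 K), w.under (𝓞 ℚ) = v ↔ (ℓ : 𝓞 K) ∈ w.asIdeal := fun w => by
    rw [under_eq_iff_natCast_primesEquiv_mem, hv]
  have finsum_eq : ∀ S : Set (HeightOneSpectrum (𝓞 K)), {w | Ideal.absNorm w.asIdeal = ℓ} = S →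
      (∑ᶠ (w : HeightOneSpectrum (𝓞 K)) (_ : Ideal.absNorm w.asIdeal = ℓ), ψ w) = ∑ᶠ w ∈ S, ψ w := by
    intro S hS; rw [← hS]; rfl
  by_cases hFrU : Φ (galoisRepTorsion W p Fr) ∈ Serre1972.unitGroup k
  · /- `ℓ` split in `K` -/
    have hFrH : Fr ∈ H := (hmemH Fr).mpr hFrU
    obtain ⟨P, 𝔔, τ, hP, hf1, hcov, hinj⟩ :=
      exists_places_split_of_mem_range (F := ℚ) (M := K) hl hHn hHi hc hunr h𝔓₀ hFr hFrH
    rw [hK2] at hcov hinj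
    have h01 : P 0 ≠ P 1 := fun h => absurd (hinj 0 (by norm_num) 1 (by norm_num) h) (by norm_num)
    -- the places of norm `ℓ` are `P 0`, `P 1`
    have hS : {w : HeightOneSpectrum (𝓞 K) | Ideal.absNorm w.asIdeal = ℓ} = {P 0, P 1} := by
      ext w
      simp only [Set.mem_setOf_eq, Set.mem_insert_iff, Set.mem_singleton_iff]
      constructor
      · intro hw
        obtain ⟨i, hi, hiw⟩ := hcov w ((hwv w).mpr (natCast_mem_of_absNorm_eq' hw))
        interval_cases i
        · exact Or.inl hiw.symm
        · exact Or.inr hiw.symm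
      · rintro (rfl | rfl)
        · rw [absNorm_eq_pow_inertiaDeg_of_under_eq hv (hP 0).1, hf1 _ (hP 0).1, pow_one]
        · rw [absNorm_eq_pow_inertiaDeg_of_under_eq hv (hP 1).1, hf1 _ (hP 1).1, pow_one]
    rw [finsum_eq _ hS, finsum_mem_pair h01]
    -- the two Frobenius values in `k`
    set y₀ : k := ⟨(Φ (galoisRepTorsion W p (absGaloisRestrict ℚ K (τ 0))) : Matrix (Fin 2) (Fin 2) (ZMod p)),
      hKU (τ 0)⟩ with hy₀
    set y₁ : k := ⟨(Φ (galoisRepTorsion W p (absGaloisRestrict ℚ K (τ 1))) : Matrix (Fin 2) (Fin 2) (ZMod p)),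
      hKU (τ 1)⟩ with hy₁
    have hres0 : absGaloisRestrict ℚ K (τ 0) = Fr := by
      rw [(hP 0).2.2.2.2, pow_zero, one_mul, inv_one, mul_one]
    have hres1 : absGaloisRestrict ℚ K (τ 1) = c * Fr * c⁻¹ := by
      rw [(hP 1).2.2.2.2, pow_one]
    have hcU : c ∉ ((Serre1972.unitGroup k).comap Φ.toMonoidHom).comap (galoisRepTorsion W p) := by
      rw [hmemU, ← hmemH]; exact hc
    have hsum : y₀ + y₁ = ((W.frobeniusTrace ℓ : ℤ) : k) := by
      apply Subtype.ext
      rw [Subalgebra.coe_add, SubringClass.coe_intCast, hy₀, hy₁, Subtype.coe_mk, Subtype.coe_mk, hres0, hres1,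
        frob_add_conj_eq_frobeniusTrace_smul_one_of_mem W p Φ hk htr hGN hℓp hgood hv h𝔓₀ hFr
          ((hmemU Fr).mpr hFrU) hcU, Int.cast_smul_eq_zsmul, zsmul_one]
    have hjsum : j y₀ + j y₁ = ((W.frobeniusTrace ℓ : ℤ) : padicAlgClResidueField p) := by
      rw [← map_add, hsum, map_intCast]
    -- the Teichmüller representatives
    set x₀ : padicAlgClIntegers p := T (j y₀) with hx₀
    set x₁ : padicAlgClIntegers p := T (j y₁) with hx₁
    have hx₀r : IsLocalRing.residue (padicAlgClIntegers p) x₀ = j y₀ := (hT _ (hjpow (τ 0))).2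
    have hx₁r : IsLocalRing.residue (padicAlgClIntegers p) x₁ = j y₁ := (hT _ (hjpow (τ 1))).2
    have hχ0 : e.symm (χv (P 0)) = (x₀ : PadicAlgCl p) := by
      rw [hχv (P 0) ((hwv _).mp (hP 0).1) (𝔔 0) (hP 0).2.1 (τ 0) (hP 0).2.2.2.1, RingEquiv.symm_apply_apply]
    have hχ1 : e.symm (χv (P 1)) = (x₁ : PadicAlgCl p) := by
      rw [hχv (P 1) ((hwv _).mp (hP 1).1) (𝔔 1) (hP 1).2.1 (τ 1) (hP 1).2.2.2.1, RingEquiv.symm_apply_apply]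
    -- `x₀ + x₁ ≡ a_ℓ(E)`
    have hmid : ‖(x₀ : PadicAlgCl p) + (x₁ : PadicAlgCl p) - (W.frobeniusTrace ℓ : PadicAlgCl p)‖ < 1 := by
      have h := norm_lt_one_of_residue_eq_zero (p := p)
        (x := x₀ + x₁ - ((W.frobeniusTrace ℓ : ℤ) : padicAlgClIntegers p))
        (by rw [map_sub, map_add, hx₀r, hx₁r, hjsum, map_intCast, sub_self])
      push_cast at h
      exact h
    have key : e.symm (ψ (P 0) + ψ (P 1)) - (W.frobeniusTrace ℓ : PadicAlgCl p) =
        (e.symm (ψ (P 0)) - (x₀ : PadicAlgCl p)) + (e.symm (ψ (P 1)) - (x₁ : PadicAlgCl p)) +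
          ((x₀ : PadicAlgCl p) + (x₁ : PadicAlgCl p) - (W.frobeniusTrace ℓ : PadicAlgCl p)) := by
      rw [map_add]; ring
    rw [key]
    refine norm_add_add_lt_one' ?_ ?_ hmid
    · have := hψ (P 0) ((hwv _).mp (hP 0).1); rwa [hχ0] at this
    · have := hψ (P 1) ((hwv _).mp (hP 1).1); rwa [hχ1] at this
  · /- `ℓ` inert in `K` -/
    have hFrH : Fr ∉ H := fun h => hFrU ((hmemH Fr).mp h)
    -- the inertia at `ℓ` acts trivially on `E[p]`, hence lies in `H`
    have hI : 𝔓₀.inertia (absoluteGaloisGroup ℚ) ≤ H := by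
      intro σ hσ
      refine (hmemH σ).mpr ?_
      rw [galoisRepTorsion_eq_one_of_mem_inertia_prime (W := W) p hℓp hgood hv h𝔓₀ hσ, map_one]
      exact one_mem _
    obtain ⟨w, 𝔔, τ, hwv', huniq, hfw, -, -, -, -⟩ :=
      exists_place_inert_of_not_mem_range (F := ℚ) (M := K) hl hHn hHi hunr h𝔓₀ hI hFr hFrH
    rw [hK2] at hfw
    have hS : {w' : HeightOneSpectrum (𝓞 K) | Ideal.absNorm w'.asIdeal = ℓ} = ∅ := by
      ext w'
      simp only [Set.mem_setOf_eq, Set.mem_empty_iff_false, iff_false]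
      intro hw'
      have hw'v : w'.under (𝓞 ℚ) = v := (hwv w').mpr (natCast_mem_of_absNorm_eq' hw')
      have heq : w' = w := huniq w' hw'v
      rw [heq, absNorm_eq_pow_inertiaDeg_of_under_eq hv hwv', hfw] at hw'
      have : ℓ ^ 2 = ℓ ^ 1 := by rw [hw', pow_one]
      exact absurd (Nat.pow_right_injective hℓ.two_le this) (by norm_num)
    rw [finsum_eq ∅ hS, finsum_mem_empty, map_zero, zero_sub, norm_neg]
    exact Literature.NumberTheory.EllipticCurves.ModularForms.HidaRank.norm_intCast_lt_one_of_dvd'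
      (dvd_frobeniusTrace_of_frob_not_mem W p Φ hk h2 htr hGN hℓp hgood hv h𝔓₀ hFr
        (fun h => hFrU ((hmemU Fr).mp h)))

end Curve

end Summit.BirchSwinnertonDyer.BirchSwinnertonDyer.Theorems.SmallImageLambdaLowerThreeNsThetaPartner

end
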